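import Mathlib.MeasureTheory.Integral.DivergenceTheorem
import Mathlib.MeasureTheory.Integral.Asymptotics
import Mathlib.Analysis.SpecialFunctions.ImproperIntegrals
import Literature.NumberTheory.LFunctions.Weil1952Criterion
import Literature.NumberTheory.LFunctions.WeilZeroSum
import HarnessLib

/-!
# Weil's criterion AS PRINTED for `ζ` is a theorem: discharge of `Weil1952_criterion_zeta`

Sibling proof file of `Literature/NumberTheory/LFunctions/Weil1952Criterion.lean`, which types the
«lemme» of

> A. Weil, *Sur les «formules explicites» de la théorie des nombres premiers*, Comm. Sém. Math.
> Univ. Lund, Tome suppl. (1952) 252–265 [bib: `Weil1952FormulesExplicites`], p. 262,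

for `L = ζ` as the named fact `Literature.NumberTheory.LFunctions.Weil1952_criterion_zeta :
RiemannHypothesis ↔ ∀ F₀, IsWeil1952Test F₀ → ∃ Z, HasWeilZeroSide (F₀ ⋆ F̃₀) Z ∧ 0 ≤ Z`, and proves
there the «il suffit» half (`Weil1952_criterion_zeta_mpr`) and the reduction
`Weil1952_criterion_zeta_of_mp`.  Here the remaining «il faut» half is proved, following Weil's
own two sentences (p. 262, right after the «lemme»): "F est alors continue et est la primitive
d'une fonction F′ continue partout sauf en un nombre fini de discontinuités de première espèce
[…]; F satisfait à (B); et, si `Φ₀` est la »transformée de Mellin« de `F₀`, celle de F est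
`Φ(s) = Φ₀(s) \overline{Φ₀(1 − s̄)}`.  Si donc tous les zéros `ω` de `L(s)` dans la bande critique
sont sur `σ = ½`, le premier membre de (11) est `≥ 0` pour ce choix de F et `Φ`."  So that


* `Weil1952_criterion_zeta_holds : Weil1952_criterion_zeta` — **Weil's criterion for `ζ`, on Weil's
  own test class (A), (B), is a THEOREM of the tree** (net literature debt −1).

## The argument (Weil 1952, p. 262, made quantitative)

For `F₀` in Weil's class — (A): `C¹` off a finite set `s` with first-kind discontinuities of `F₀`
and `F₀′` and the midpoint convention; (B): `F₀, F₀′ = O(e^{−(1/2+b)|x|})` — we show: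

1. `F₀` and `deriv F₀` are integrable (`IsWeil1952Test.integrable`): locally, a function that is
   continuous off a finite set and has finite one-sided limits there is locally bounded, hence
   locally integrable; at infinity (B) dominates by the integrable `e^{−(1/2+b)|x|}`
   (`MeasureTheory.LocallyIntegrable.integrable_of_isBigO_cocompact`).
2. **Decay of the transform on the critical line** (`IsWeil1952Test.exists_norm_weilMellin_mul_le`):
   `‖Φ₀(½ + iγ)‖ · (1 + |γ|) ≤ C(F₀)`.  Subtract the jumps: with `J_a = F₀(a+0) − F₀(a−0)` and the
   model jump `j(x) = ½ sign(x) e^{−|x|}` (whose transform is `iγ/(1+γ²)`, computed from the two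
   half-line integrals), `G = F₀ − Σ_a J_a j(· − a)` is CONTINUOUS (this is where the midpoint
   convention of (A) enters), differentiable off `s`, integrable with integrable derivative and
   `G → 0` at `±∞`; the fundamental theorem of calculus for functions differentiable off a countable
   set (`MeasureTheory.integral_eq_of_hasDerivAt_off_countable`) on `[−R, R]`, `R → ∞`, gives
   `iγ Ĝ(γ) = −(G′)^(γ)`, whence `|γ| ‖Ĝ(γ)‖ ≤ ‖G′‖₁` and `‖Ĝ(γ)‖ ≤ ‖G‖₁`.
3. **Convolution on the critical line for integrable functions**
   (`weilMellin_weilConv_of_integrable`, Fubini as in `weilMellin_weilConv_holds` but with `L¹`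
   hypotheses, `|e^{iγt}| = 1`), and `(F̃₀)^(ρ) = conj Φ₀(1 − ρ̄)` (`weilMellin_weilReflect_holds`):
   for `Re ρ = ½`, `(F₀ ⋆ F̃₀)^(ρ) = |Φ₀(ρ)|²` (`weilMellin_autocorr_of_integrable`).
4. **Absolute convergence of the zero side**: under RH every non-trivial zero has `Re ρ = ½`,
   `‖ρ‖² = ¼ + γ² ≤ (1 + |γ|)²`, so `m(ρ) |Φ₀(ρ)|² ≤ C² m(ρ)/‖ρ‖²`, summable by the tree's Jensen
   bound `Literature.NumberTheory.LFunctions.summable_zeroOrder_div_norm_sq` (zeros with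
   `Re ρ ≥ ¼`; Titchmarsh Thm. 9.2); hence the symmetric truncations converge
   (`hasWeilZeroSide_tsum`, `WeilZeroSum.lean`) and the limit is a sum of non-negative reals.

Steps 2 and 4 replace Weil's appeal to his general explicit formula (11) (which gives the
EXISTENCE of the limit for every `F` in (A), (B), with or without RH, and which the tree proves only
for `C_c^∞`, `explicit_formula_holds`): under RH the terms `Φ(ω) = |Φ₀(ω)|²` are non-negative, so
absolute convergence — which only needs the decay of `Φ₀` and the density of zeros — already gives
the limit and its sign.  Nothing here is new mathematics.

## References

* A. Weil, Comm. Sém. Math. Univ. Lund, Tome suppl. (1952) 252–265 = Œuvres Sci. II [1952b]: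
  conditions (A), (B) p. 257; the «lemme» and its proof, p. 262. [Weil1952FormulesExplicites]
* E. Bombieri, Rend. Lincei (9) 11 (2000) 183–233, §3 (3.2) (`Σ |g̃(ρ)|² ≥ 0` under RH).
  [Bombieri2000Weil]
* E. C. Titchmarsh, *The Theory of the Riemann Zeta-Function*, 2nd ed. (1986), Thm. 9.2 (density of
  zeros, behind `summable_zeroOrder_div_norm_sq`). [Titchmarsh1986]
-/

noncomputable section

open Complex Filter Set MeasureTheory Asymptotics
open scoped Real Topology Convolution ComplexConjugate ComplexOrder

namespace Literature.NumberTheory.LFunctions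

namespace Weil1952

/-! ## Elementary helpers: the character `t ↦ e^{iγt}` and exponential weights -/

/-- `‖e^{iγt}‖ = 1` for real `γ, t`. [folklore] -/
private theorem norm_cexp_mul_I_mul (γ t : ℝ) : ‖cexp (γ * I * t)‖ = 1 := by
  rw [show (γ : ℂ) * I * t = ((γ * t : ℝ) : ℂ) * I by push_cast; ring]
  exact Complex.norm_exp_ofReal_mul_I _

/-- `d/dt e^{iγt} = iγ e^{iγt}` (real variable `t`). [folklore] -/
private theorem hasDerivAt_cexp_mul_I_mul (γ t : ℝ) :
    HasDerivAt (fun x : ℝ ↦ cexp (γ * I * x)) (γ * I * cexp (γ * I * t)) t := by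
  have h : HasDerivAt (fun z : ℂ ↦ cexp (γ * I * z)) (cexp (γ * I * t) * (γ * I * 1)) (t : ℂ) :=
    ((hasDerivAt_id (t : ℂ)).const_mul (γ * I)).cexp
  convert h.comp_ofReal using 1
  ring

/-- An integrable `G` stays integrable after multiplication by `e^{iγt}`. [folklore] -/
private theorem integrable_mul_cexp {G : ℝ → ℂ} (hG : Integrable G) (γ : ℝ) :
    Integrable fun t : ℝ ↦ G t * cexp (γ * I * t) := by
  refine hG.norm.mono' (hG.aestronglyMeasurable.mul (Continuous.aestronglyMeasurable (by fun_prop)))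
    (Eventually.of_forall fun t ↦ ?_)
  rw [norm_mul, norm_cexp_mul_I_mul, mul_one]

/-- `‖∫ G(t) e^{iγt} dt‖ ≤ ∫ ‖G‖`. [folklore] -/
private theorem norm_integral_mul_cexp_le (G : ℝ → ℂ) (γ : ℝ) :
    ‖∫ t : ℝ, G t * cexp (γ * I * t)‖ ≤ ∫ t : ℝ, ‖G t‖ := by
  refine (norm_integral_le_integral_norm _).trans_eq ?_
  congr 1 with t
  rw [norm_mul, norm_cexp_mul_I_mul, mul_one]

/-- On the critical line the tree's transform is the Fourier transform:
`ĝ(½ + iγ) = ∫ g(t) e^{iγt} dt` (`weilMellin g s = ∫ g(t) e^{(s − ½)t} dt`). [folklore] -/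
private theorem weilMellin_half_add (g : ℝ → ℂ) (γ : ℝ) :
    weilMellin g (1 / 2 + γ * I) = ∫ t : ℝ, g t * cexp (γ * I * t) := by
  unfold weilMellin
  congr 1 with t
  congr 2
  ring

/-- Transform of a translate: `∫ φ(t − a) e^{iγt} dt = e^{iγa} ∫ φ(t) e^{iγt} dt`. [folklore] -/
private theorem integral_comp_sub_mul_cexp (φ : ℝ → ℂ) (a γ : ℝ) :
    ∫ t : ℝ, φ (t - a) * cexp (γ * I * t) = cexp (γ * I * a) * ∫ t : ℝ, φ t * cexp (γ * I * t) := by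
  rw [← integral_add_right_eq_self (fun t : ℝ ↦ φ (t - a) * cexp (γ * I * t)) a,
    ← integral_const_mul]
  congr 1 with t
  simp only [add_sub_cancel_right]
  rw [show (γ : ℂ) * I * ((t + a : ℝ) : ℂ) = γ * I * a + γ * I * t by push_cast; ring,
    Complex.exp_add]
  ring

/-- `e^{−c|x|} → 0` along `cocompact ℝ` for `c > 0`. [folklore] -/
private theorem tendsto_exp_neg_mul_abs_cocompact {c : ℝ} (hc : 0 < c) :
    Tendsto (fun x : ℝ ↦ Real.exp (-c * |x|)) (cocompact ℝ) (𝓝 0) := by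
  have h1 : Tendsto (fun x : ℝ ↦ |x|) (cocompact ℝ) atTop := by
    have h := tendsto_norm_cocompact_atTop (E := ℝ)
    refine h.congr fun x ↦ ?_
    simp [Real.norm_eq_abs]
  have h2 : Tendsto (fun x : ℝ ↦ -c * |x|) (cocompact ℝ) atBot := by
    have h := tendsto_neg_atTop_atBot.comp (h1.const_mul_atTop hc)
    refine h.congr fun x ↦ ?_
    simp [neg_mul]
  exact Real.tendsto_exp_atBot.comp h2

/-- `e^{−|x|} → 0` along `cocompact ℝ`. [folklore] -/
private theorem tendsto_exp_neg_abs_cocompact :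
    Tendsto (fun x : ℝ ↦ Real.exp (-|x|)) (cocompact ℝ) (𝓝 0) := by
  have h := tendsto_exp_neg_mul_abs_cocompact one_pos
  refine h.congr fun x ↦ ?_
  simp

/-- `x ↦ e^{−c|x|}` is integrable on `ℝ` for `c > 0`. [folklore] -/
private theorem integrable_exp_neg_mul_abs {c : ℝ} (hc : 0 < c) :
    Integrable fun x : ℝ ↦ Real.exp (-c * |x|) := by
  have h1 : IntegrableOn (fun x : ℝ ↦ Real.exp (-c * |x|)) (Iic 0) := by
    refine (integrableOn_exp_mul_Iic hc 0).congr_fun (fun x hx ↦ ?_) measurableSet_Iic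
    rw [abs_of_nonpos hx, show -c * -x = c * x by ring]
  have h2 : IntegrableOn (fun x : ℝ ↦ Real.exp (-c * |x|)) (Ioi 0) := by
    refine (integrableOn_exp_mul_Ioi (neg_lt_zero.2 hc) 0).congr_fun (fun x hx ↦ ?_)
      measurableSet_Ioi
    rw [abs_of_pos hx]
  have h := h1.union h2
  rwa [Iic_union_Ioi, integrableOn_univ] at h

/-- `x ↦ e^{−|x|}` is integrable on `ℝ`. [folklore] -/
private theorem integrable_exp_neg_abs : Integrable fun x : ℝ ↦ Real.exp (-|x|) := by
  have h := integrable_exp_neg_mul_abs one_pos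
  refine h.congr (Eventually.of_forall fun x ↦ ?_)
  simp

/-! ## Functions continuous off a finite set with one-sided limits: measurability, integrability -/

/-- A function continuous off a finite set is a.e.-strongly measurable (Lebesgue measure has no
atoms). [folklore] -/
private theorem aestronglyMeasurable_of_continuousOn_compl {f : ℝ → ℂ} (s : Finset ℝ)
    (hf : ContinuousOn f (↑s : Set ℝ)ᶜ) : AEStronglyMeasurable f volume := by
  have h := hf.aestronglyMeasurable (μ := volume) s.finite_toSet.isClosed.measurableSet.compl
  rwa [Measure.restrict_eq_self_of_ae_mem] at h
  exact (measure_eq_zero_iff_ae_notMem.1 (Finset.measure_zero s volume)).mono fun x hx ↦ hx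

/-- **Local boundedness from condition (A).**  If `f` is continuous off the finite set `s` and has
finite one-sided limits at each point of `s`, then `f` is bounded near every point. [folklore] -/
private theorem exists_eventually_norm_le {f : ℝ → ℂ} {s : Finset ℝ}
    (hf : ContinuousOn f (↑s : Set ℝ)ᶜ)
    (hl : ∀ a ∈ s, ∃ l₁ l₂ : ℂ, Tendsto f (𝓝[<] a) (𝓝 l₁) ∧ Tendsto f (𝓝[>] a) (𝓝 l₂))
    (x : ℝ) : ∃ C : ℝ, ∀ᶠ y in 𝓝 x, ‖f y‖ ≤ C := by
  by_cases hx : x ∈ s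
  · obtain ⟨l₁, l₂, h₁, h₂⟩ := hl x hx
    have e₁ : ∀ᶠ y in 𝓝[<] x, ‖f y‖ < ‖l₁‖ + 1 := h₁.norm.eventually (gt_mem_nhds (lt_add_one _))
    have e₂ : ∀ᶠ y in 𝓝[>] x, ‖f y‖ < ‖l₂‖ + 1 := h₂.norm.eventually (gt_mem_nhds (lt_add_one _))
    refine ⟨max (max (‖l₁‖ + 1) (‖l₂‖ + 1)) ‖f x‖, ?_⟩
    rw [← nhdsNE_sup_pure, ← nhdsLT_sup_nhdsGT, eventually_sup, eventually_sup, eventually_pure]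
    exact ⟨⟨e₁.mono fun y hy ↦ hy.le.trans ((le_max_left _ _).trans (le_max_left _ _)),
      e₂.mono fun y hy ↦ hy.le.trans ((le_max_right _ _).trans (le_max_left _ _))⟩,
      le_max_right _ _⟩
  · have hx' : x ∈ ((↑s : Set ℝ)ᶜ) := by simpa using hx
    have hc : ContinuousAt f x :=
      hf.continuousAt (s.finite_toSet.isClosed.isOpen_compl.mem_nhds hx')
    refine ⟨‖f x‖ + 1, ?_⟩
    exact (hc.norm.eventually (gt_mem_nhds (lt_add_one _))).mono fun y hy ↦ hy.le

/-- An a.e.-strongly measurable function that is bounded near every point is locally integrable.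
[folklore] -/
private theorem locallyIntegrable_of_eventually_norm_le {f : ℝ → ℂ}
    (hf : AEStronglyMeasurable f volume)
    (h : ∀ x, ∃ C : ℝ, ∀ᶠ y in 𝓝 x, ‖f y‖ ≤ C) : LocallyIntegrable f volume := by
  intro x
  obtain ⟨C, hC⟩ := h x
  exact Measure.FiniteAtFilter.integrableAtFilter hf.stronglyMeasurableAtFilter
    (volume.finiteAt_nhds x) ⟨C, hC⟩

/-- **Integrability from (A) + (B)** (the pattern used for both `F` and `F′`): continuous off a
finite set with one-sided limits there (local integrability) and `O(e^{−(1/2+b)|x|})` at infinity.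
[cite: Weil1952FormulesExplicites, conditions (A), (B), p. 257] -/
private theorem integrable_of_condAB_aux {f : ℝ → ℂ} {s : Finset ℝ}
    (hf : ContinuousOn f (↑s : Set ℝ)ᶜ)
    (hl : ∀ a ∈ s, ∃ l₁ l₂ : ℂ, Tendsto f (𝓝[<] a) (𝓝 l₁) ∧ Tendsto f (𝓝[>] a) (𝓝 l₂))
    {b : ℝ} (hb : 0 < b) (hO : f =O[cocompact ℝ] fun x ↦ Real.exp (-(1 / 2 + b) * |x|)) :
    Integrable f := by
  have hmeas := aestronglyMeasurable_of_continuousOn_compl s hf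
  have hloc := locallyIntegrable_of_eventually_norm_le hmeas (exists_eventually_norm_le hf hl)
  exact hloc.integrable_of_isBigO_cocompact hO
    ((integrable_exp_neg_mul_abs (by linarith : 0 < 1 / 2 + b)).integrableAtFilter _)

/-- **Weil's test functions are integrable.**
[cite: Weil1952FormulesExplicites, conditions (A), (B), p. 257] -/
theorem _root_.Literature.NumberTheory.LFunctions.IsWeil1952Test.integrable {F : ℝ → ℂ}
    (hF : IsWeil1952Test F) : Integrable F := by
  obtain ⟨⟨s, hFs, hA⟩, ⟨b, hb, hOF, -⟩⟩ := hF
  refine integrable_of_condAB_aux hFs.continuousOn (fun a ha ↦ ?_) hb hOF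
  obtain ⟨⟨l₁, l₂, h1, h2, -⟩, -⟩ := hA a ha
  exact ⟨l₁, l₂, h1, h2⟩

/-! ## The model jump `j(x) = ½ sign(x) e^{−|x|}` -/

/- The model unit jump `j(x) = ½ sign(x) e^{−|x|}`, written out below as the plain expression
`((Real.sign x * Real.exp (-|x|) / 2 : ℝ) : ℂ)` (no definition, no notation): `j(0+) = ½`,
`j(0−) = −½`, `j(0) = 0` (the midpoint), `C^∞` off `0` with `j′(x) = −½ e^{−|x|}`, and
`∫ j(t) e^{iγt} dt = iγ/(1 + γ²)`.  Used to remove the first-kind discontinuities of a function of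
Weil's class (A). -/

/-- `j(x) = ½ e^{−x}` for `x > 0`. [folklore] -/
private theorem jump_of_pos {x : ℝ} (hx : 0 < x) :
    (((Real.sign x * Real.exp (-|x|) / 2 : ℝ)) : ℂ) = ((Real.exp (-x) / 2 : ℝ) : ℂ) := by
  simp [Real.sign_of_pos hx, abs_of_pos hx]

/-- `j(x) = −½ eˣ` for `x < 0`. [folklore] -/
private theorem jump_of_neg {x : ℝ} (hx : x < 0) :
    (((Real.sign x * Real.exp (-|x|) / 2 : ℝ)) : ℂ) = ((-Real.exp x / 2 : ℝ) : ℂ) := by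
  simp [Real.sign_of_neg hx, abs_of_neg hx, neg_div]

/-- `j(0) = 0`. [folklore] -/
@[simp] private theorem jump_zero :
    (((Real.sign (0 : ℝ) * Real.exp (-|(0 : ℝ)|) / 2 : ℝ)) : ℂ) = 0 := by
  simp

/-- `‖j(x)‖ ≤ ½ e^{−|x|}`. [folklore] -/
private theorem norm_jump_le (x : ℝ) :
    ‖(((Real.sign x * Real.exp (-|x|) / 2 : ℝ)) : ℂ)‖ ≤ Real.exp (-|x|) / 2 := by
  rw [Complex.norm_real, Real.norm_eq_abs, abs_div, abs_mul, abs_of_pos (Real.exp_pos _),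
    abs_two]
  have h : |Real.sign x| ≤ 1 := by
    rcases Real.sign_apply_eq x with h | h | h <;> simp [h]
  have := mul_le_mul_of_nonneg_right h (Real.exp_pos (-|x|)).le
  linarith

/-- `j′(x) = −½ e^{−|x|}` for `x ≠ 0`. [folklore] -/
private theorem hasDerivAt_jump {x : ℝ} (hx : x ≠ 0) :
    HasDerivAt (fun y : ℝ ↦ (((Real.sign y * Real.exp (-|y|) / 2 : ℝ)) : ℂ))
      (((-Real.exp (-|x|) / 2 : ℝ)) : ℂ) x := by
  rcases hx.lt_or_gt with hx | hx
  · -- `x < 0`: locally `j(y) = −½ e^{y}`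
    have hreal : HasDerivAt (fun y : ℝ ↦ -Real.exp y / 2) (-Real.exp x / 2) x :=
      (Real.hasDerivAt_exp x).neg.div_const 2
    have hC : HasDerivAt (fun y : ℝ ↦ ((-Real.exp y / 2 : ℝ) : ℂ))
        (((-Real.exp x / 2 : ℝ)) : ℂ) x := hreal.ofReal_comp
    have hx' : -|x| = x := by rw [abs_of_neg hx, neg_neg]
    rw [hx']
    refine hC.congr_of_eventuallyEq ?_
    exact (gt_mem_nhds hx).mono fun y hy ↦ jump_of_neg hy
  · -- `x > 0`: locally `j(y) = ½ e^{−y}`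
    have hreal : HasDerivAt (fun y : ℝ ↦ Real.exp (-y) / 2) (Real.exp (-x) * -1 / 2) x :=
      ((Real.hasDerivAt_exp (-x)).comp x (hasDerivAt_neg x)).div_const 2
    have hC : HasDerivAt (fun y : ℝ ↦ ((Real.exp (-y) / 2 : ℝ) : ℂ))
        (((Real.exp (-x) * -1 / 2 : ℝ)) : ℂ) x := hreal.ofReal_comp
    have hx' : -|x| = -x := by rw [abs_of_pos hx]
    rw [hx', show (-Real.exp (-x) / 2 : ℝ) = Real.exp (-x) * -1 / 2 by ring]
    refine hC.congr_of_eventuallyEq ?_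
    exact (lt_mem_nhds hx).mono fun y hy ↦ jump_of_pos hy

/-- `j` is continuous off `0`. [folklore] -/
private theorem continuousOn_jump :
    ContinuousOn (fun y : ℝ ↦ (((Real.sign y * Real.exp (-|y|) / 2 : ℝ)) : ℂ))
      (↑({0} : Finset ℝ) : Set ℝ)ᶜ := by
  intro x hx
  have hx' : x ≠ 0 := by simpa using hx
  exact (hasDerivAt_jump hx').continuousAt.continuousWithinAt

/-- `j(0+) = ½`. [folklore] -/
private theorem tendsto_jump_nhdsGT :
    Tendsto (fun y : ℝ ↦ (((Real.sign y * Real.exp (-|y|) / 2 : ℝ)) : ℂ)) (𝓝[>] 0)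
      (𝓝 (((1 / 2 : ℝ)) : ℂ)) := by
  have h : Tendsto (fun y : ℝ ↦ ((Real.exp (-y) / 2 : ℝ) : ℂ)) (𝓝 0)
      (𝓝 (((Real.exp (-0) / 2 : ℝ)) : ℂ)) :=
    (by fun_prop : Continuous fun y : ℝ ↦ ((Real.exp (-y) / 2 : ℝ) : ℂ)).tendsto 0
  rw [neg_zero, Real.exp_zero] at h
  refine (h.mono_left nhdsWithin_le_nhds).congr' ?_
  exact eventually_nhdsWithin_of_forall fun y hy ↦ (jump_of_pos hy).symm

/-- `j(0−) = −½`. [folklore] -/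
private theorem tendsto_jump_nhdsLT :
    Tendsto (fun y : ℝ ↦ (((Real.sign y * Real.exp (-|y|) / 2 : ℝ)) : ℂ)) (𝓝[<] 0)
      (𝓝 (((-1 / 2 : ℝ)) : ℂ)) := by
  have h : Tendsto (fun y : ℝ ↦ ((-Real.exp y / 2 : ℝ) : ℂ)) (𝓝 0)
      (𝓝 (((-Real.exp 0 / 2 : ℝ)) : ℂ)) :=
    (by fun_prop : Continuous fun y : ℝ ↦ ((-Real.exp y / 2 : ℝ) : ℂ)).tendsto 0
  rw [Real.exp_zero] at h
  refine (h.mono_left nhdsWithin_le_nhds).congr' ?_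
  exact eventually_nhdsWithin_of_forall fun y hy ↦ (jump_of_neg hy).symm

/-- `j` is integrable. [folklore] -/
private theorem integrable_jump :
    Integrable fun y : ℝ ↦ (((Real.sign y * Real.exp (-|y|) / 2 : ℝ)) : ℂ) := by
  refine (integrable_exp_neg_abs.div_const 2).mono'
    (aestronglyMeasurable_of_continuousOn_compl {0} continuousOn_jump)
    (Eventually.of_forall fun x ↦ ?_)
  exact norm_jump_le x

/-- The derivative profile `x ↦ −½ e^{−|x|}` of `j` is integrable. [folklore] -/
private theorem integrable_jumpDeriv :
    Integrable fun x : ℝ ↦ (((-Real.exp (-|x|) / 2 : ℝ)) : ℂ) :=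
  (integrable_exp_neg_abs.neg.div_const 2).ofReal

/-- Translates of `j` tend to `0` at infinity. [folklore] -/
private theorem tendsto_jump_comp_sub_cocompact (a : ℝ) :
    Tendsto (fun x : ℝ ↦ (((Real.sign (x - a) * Real.exp (-|x - a|) / 2 : ℝ)) : ℂ)) (cocompact ℝ)
      (𝓝 0) := by
  have hle : ∀ x : ℝ,
      ‖(((Real.sign (x - a) * Real.exp (-|x - a|) / 2 : ℝ)) : ℂ)‖ ≤
        Real.exp |a| / 2 * Real.exp (-|x|) := by
    intro x
    refine (norm_jump_le (x - a)).trans ?_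
    have h1 : -|x - a| ≤ |a| + -|x| := by
      have := abs_sub_abs_le_abs_sub x a
      linarith
    have h2 : Real.exp (-|x - a|) ≤ Real.exp |a| * Real.exp (-|x|) := by
      rw [← Real.exp_add]
      exact Real.exp_le_exp.2 h1
    linarith
  have h := tendsto_exp_neg_abs_cocompact.const_mul (Real.exp |a| / 2)
  rw [mul_zero] at h
  exact squeeze_zero_norm hle h

/-- **Transform of the model jump**: `∫ j(t) e^{iγt} dt = iγ/(1 + γ²)` (the two half-line integrals
`∫₀^∞ ½ e^{(iγ−1)t} dt = 1/(2(1−iγ))`, `∫_{−∞}^0 (−½) e^{(iγ+1)t} dt = −1/(2(1+iγ))`). [folklore] -/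
private theorem integral_jump_mul_cexp (γ : ℝ) :
    ∫ t : ℝ, (((Real.sign t * Real.exp (-|t|) / 2 : ℝ)) : ℂ) * cexp (γ * I * t) =
      γ * I / (1 + γ ^ 2) := by
  have hint := integrable_mul_cexp integrable_jump γ
  have h1 : (1 : ℂ) - γ * I ≠ 0 := by
    intro h
    have := congrArg Complex.re h
    simp at this
  have h2 : (1 : ℂ) + γ * I ≠ 0 := by
    intro h
    have := congrArg Complex.re h
    simp at this
  have h1' : (γ * I - 1 : ℂ) ≠ 0 := fun h ↦ h1 (by linear_combination -h)
  have h2' : (γ * I + 1 : ℂ) ≠ 0 := fun h ↦ h2 (by linear_combination h)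
  have hIoi :
      ∫ t in Ioi (0 : ℝ), (((Real.sign t * Real.exp (-|t|) / 2 : ℝ)) : ℂ) * cexp (γ * I * t) =
        1 / (2 * (1 - γ * I)) := by
    have hre : (γ * I - 1 : ℂ).re < 0 := by simp
    calc ∫ t in Ioi (0 : ℝ), (((Real.sign t * Real.exp (-|t|) / 2 : ℝ)) : ℂ) * cexp (γ * I * t)
        = ∫ t in Ioi (0 : ℝ), (1 / 2 : ℂ) * cexp ((γ * I - 1) * t) := by
          refine setIntegral_congr_fun measurableSet_Ioi fun t (ht : 0 < t) ↦ ?_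
          rw [jump_of_pos ht,
            show (γ * I - 1 : ℂ) * t = ((-t : ℝ) : ℂ) + γ * I * t by push_cast; ring,
            Complex.exp_add, ← Complex.ofReal_exp]
          push_cast
          ring
      _ = 1 / (2 * (1 - γ * I)) := by
          rw [integral_const_mul, integral_exp_mul_complex_Ioi hre 0]
          simp only [Complex.ofReal_zero, mul_zero, Complex.exp_zero]
          field_simp
          ring
  have hIic :
      ∫ t in Iic (0 : ℝ), (((Real.sign t * Real.exp (-|t|) / 2 : ℝ)) : ℂ) * cexp (γ * I * t) =
        -(1 / (2 * (1 + γ * I))) := by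
    have hre : 0 < (γ * I + 1 : ℂ).re := by simp
    rw [integral_Iic_eq_integral_Iio]
    calc ∫ t in Iio (0 : ℝ), (((Real.sign t * Real.exp (-|t|) / 2 : ℝ)) : ℂ) * cexp (γ * I * t)
        = ∫ t in Iio (0 : ℝ), (-(1 / 2) : ℂ) * cexp ((γ * I + 1) * t) := by
          refine setIntegral_congr_fun measurableSet_Iio fun t (ht : t < 0) ↦ ?_
          rw [jump_of_neg ht, show (γ * I + 1 : ℂ) * t = ((t : ℝ) : ℂ) + γ * I * t by ring,
            Complex.exp_add, ← Complex.ofReal_exp]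
          push_cast
          ring
      _ = -(1 / (2 * (1 + γ * I))) := by
          rw [integral_const_mul, ← integral_Iic_eq_integral_Iio,
            integral_exp_mul_complex_Iic hre 0]
          simp only [Complex.ofReal_zero, mul_zero, Complex.exp_zero]
          field_simp
          ring
  rw [← intervalIntegral.integral_Iic_add_Ioi hint.integrableOn hint.integrableOn, hIic, hIoi]
  have h3 : (1 : ℂ) + γ ^ 2 ≠ 0 := by exact_mod_cast (by positivity : (1 : ℝ) + γ ^ 2 ≠ 0)
  have hD : (1 + γ * I) * (1 - γ * I) = (1 + γ ^ 2 : ℂ) := by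
    ring_nf
    rw [Complex.I_sq]
    ring
  rw [← hD]
  field_simp
  ring

/-- The decay bound for the model jump's transform: `|γ|/(1+γ²) · (1 + |γ|) ≤ 3/2`. [folklore] -/
private theorem norm_jumpTransform_mul_le (γ : ℝ) :
    ‖(γ * I / (1 + γ ^ 2) : ℂ)‖ * (1 + |γ|) ≤ 3 / 2 := by
  have h1 : (1 + (γ : ℂ) ^ 2) = ((1 + γ ^ 2 : ℝ) : ℂ) := by push_cast; ring
  have hpos : 0 < 1 + γ ^ 2 := by positivity
  rw [h1, norm_div, norm_mul, Complex.norm_I, mul_one, Complex.norm_real, Complex.norm_real,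
    Real.norm_eq_abs, Real.norm_eq_abs, abs_of_pos hpos, div_mul_eq_mul_div, div_le_iff₀ hpos]
  nlinarith [abs_nonneg γ, sq_abs γ, sq_nonneg (|γ| - 1)]

/-! ## Integration by parts against `e^{iγt}` off a countable set -/

/-- **`iγ Ĝ(γ) = −(G′)^(γ)` for a continuous integrable `G`, differentiable off a countable set with
integrable derivative and vanishing at `±∞`.**  Fundamental theorem of calculus for
`u = G · e^{iγ·}` on `[−R, R]` (`MeasureTheory.integral_eq_of_hasDerivAt_off_countable`), then
`R → ∞`. [folklore] -/
private theorem integral_mul_cexp_eq_of_hasDerivAt_off_countable {G G' : ℝ → ℂ} {s : Set ℝ}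
    (hs : s.Countable) (hGc : Continuous G) (hGd : ∀ x, x ∉ s → HasDerivAt G (G' x) x)
    (hGi : Integrable G) (hG'i : Integrable G') (htop : Tendsto G atTop (𝓝 0))
    (hbot : Tendsto G atBot (𝓝 0)) (γ : ℝ) :
    (γ * I) * ∫ t : ℝ, G t * cexp (γ * I * t) = -∫ t : ℝ, G' t * cexp (γ * I * t) := by
  set e : ℝ → ℂ := fun t ↦ cexp (γ * I * t) with he
  set u : ℝ → ℂ := fun t ↦ G t * e t with hu
  set u' : ℝ → ℂ := fun t ↦ G' t * e t + G t * (γ * I * e t) with hu'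
  have hi1 : Integrable fun t ↦ G' t * e t := integrable_mul_cexp hG'i γ
  have hi2 : Integrable fun t ↦ G t * (γ * I * e t) := by
    refine ((integrable_mul_cexp hGi γ).const_mul (γ * I)).congr (Eventually.of_forall fun t ↦ ?_)
    simp only [he]
    ring
  have hu'i : Integrable u' := hi1.add hi2
  have hFTC : ∀ R : ℝ, ∫ t in (-R)..R, u' t = u R - u (-R) := by
    intro R
    refine integral_eq_of_hasDerivAt_off_countable u u' hs
      (hGc.mul (by fun_prop : Continuous e)).continuousOn (fun x hx ↦ ?_) hu'i.intervalIntegrable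
    exact (hGd x hx.2).mul (hasDerivAt_cexp_mul_I_mul γ x)
  have hlim1 : Tendsto (fun R : ℝ ↦ u R - u (-R)) atTop (𝓝 (∫ t, u' t)) :=
    (intervalIntegral_tendsto_integral hu'i tendsto_neg_atTop_atBot tendsto_id).congr hFTC
  have hu0 : ∀ {l : Filter ℝ}, Tendsto G l (𝓝 0) → Tendsto u l (𝓝 0) := by
    intro l hl
    rw [tendsto_zero_iff_norm_tendsto_zero] at hl ⊢
    refine hl.congr fun R ↦ ?_
    simp only [hu, he, norm_mul, norm_cexp_mul_I_mul, mul_one]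
  have hlim2 : Tendsto (fun R : ℝ ↦ u R - u (-R)) atTop (𝓝 (0 - 0)) :=
    (hu0 htop).sub ((hu0 hbot).comp tendsto_neg_atTop_atBot)
  rw [sub_zero] at hlim2
  have hint0 : ∫ t, u' t = 0 := tendsto_nhds_unique hlim1 hlim2
  have hsplit : ∫ t, u' t = (∫ t, G' t * e t) + (γ * I) * ∫ t, G t * e t := by
    rw [integral_add hi1 hi2, ← integral_const_mul]
    congr 1
    exact integral_congr_ae (Eventually.of_forall fun t ↦ by simp only; ring)
  rw [hsplit] at hint0
  exact eq_neg_of_add_eq_zero_right hint0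

/-! ## Removing the jumps of a function of class (A) -/

/-- `y ↦ y − a` maps `𝓝[<] a` to `𝓝[<] 0`. [folklore] -/
private theorem tendsto_sub_nhdsLT (a : ℝ) : Tendsto (fun y : ℝ ↦ y - a) (𝓝[<] a) (𝓝[<] 0) := by
  refine tendsto_nhdsWithin_iff.2 ⟨?_, ?_⟩
  · have h : Tendsto (fun y : ℝ ↦ y - a) (𝓝 a) (𝓝 (a - a)) := tendsto_id.sub tendsto_const_nhds
    rw [sub_self] at h
    exact h.mono_left nhdsWithin_le_nhds
  · exact eventually_nhdsWithin_of_forall fun y (hy : y < a) ↦ show y - a < 0 by linarith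

/-- `y ↦ y − a` maps `𝓝[>] a` to `𝓝[>] 0`. [folklore] -/
private theorem tendsto_sub_nhdsGT (a : ℝ) : Tendsto (fun y : ℝ ↦ y - a) (𝓝[>] a) (𝓝[>] 0) := by
  refine tendsto_nhdsWithin_iff.2 ⟨?_, ?_⟩
  · have h : Tendsto (fun y : ℝ ↦ y - a) (𝓝 a) (𝓝 (a - a)) := tendsto_id.sub tendsto_const_nhds
    rw [sub_self] at h
    exact h.mono_left nhdsWithin_le_nhds
  · exact eventually_nhdsWithin_of_forall fun y (hy : a < y) ↦ show 0 < y - a by linarith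

/-- **Jump removal.**  Let `F` be `C¹` off the finite set `s`, with one-sided limits `l₁(a)` (left),
`l₂(a)` (right) at each `a ∈ s` and the midpoint convention `F(a) = ½(l₁(a) + l₂(a))` (Weil's
condition (A)).  Then `G = F − Σ_{a∈s} (l₂(a) − l₁(a)) · j(· − a)` is continuous on `ℝ`, and off `s`
it is differentiable with `G′ = F′ − Σ_a (l₂(a) − l₁(a)) · j′(· − a)`, `j′(y) = −½ e^{−|y|}`.
[cite: Weil1952FormulesExplicites, condition (A), p. 257] -/
private theorem jump_removal {F : ℝ → ℂ} {s : Finset ℝ} {l₁ l₂ : ℝ → ℂ}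
    (hF : ContDiffOn ℝ 1 F (↑s : Set ℝ)ᶜ)
    (h₁ : ∀ a ∈ s, Tendsto F (𝓝[<] a) (𝓝 (l₁ a)))
    (h₂ : ∀ a ∈ s, Tendsto F (𝓝[>] a) (𝓝 (l₂ a)))
    (hmid : ∀ a ∈ s, F a = (l₁ a + l₂ a) / 2) :
    Continuous (fun x ↦ F x - ∑ a ∈ s, (l₂ a - l₁ a) *
        (((Real.sign (x - a) * Real.exp (-|x - a|) / 2 : ℝ)) : ℂ)) ∧
      ∀ x, x ∉ s → HasDerivAt (fun x ↦ F x - ∑ a ∈ s, (l₂ a - l₁ a) *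
          (((Real.sign (x - a) * Real.exp (-|x - a|) / 2 : ℝ)) : ℂ))
        (deriv F x - ∑ a ∈ s, (l₂ a - l₁ a) * (((-Real.exp (-|x - a|) / 2 : ℝ)) : ℂ)) x := by
  have hopen : IsOpen ((↑s : Set ℝ)ᶜ) := s.finite_toSet.isClosed.isOpen_compl
  have hderiv : ∀ x, x ∉ s → HasDerivAt (fun x ↦ F x - ∑ a ∈ s, (l₂ a - l₁ a) *
        (((Real.sign (x - a) * Real.exp (-|x - a|) / 2 : ℝ)) : ℂ))
      (deriv F x - ∑ a ∈ s, (l₂ a - l₁ a) * (((-Real.exp (-|x - a|) / 2 : ℝ)) : ℂ)) x := by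
    intro x hx
    have hx' : x ∈ ((↑s : Set ℝ)ᶜ) := by simpa using hx
    have hFx : HasDerivAt F (deriv F x) x :=
      ((hF.differentiableOn one_ne_zero).differentiableAt (hopen.mem_nhds hx')).hasDerivAt
    refine hFx.sub (HasDerivAt.fun_sum fun a ha ↦ ?_)
    have hxa : x - a ≠ 0 := sub_ne_zero.2 fun h ↦ hx (h ▸ ha)
    exact ((hasDerivAt_jump hxa).comp_sub_const x a).const_mul _
  refine ⟨continuous_iff_continuousAt.2 fun x ↦ ?_, hderiv⟩
  by_cases hx : x ∈ s
  swap
  · exact (hderiv x hx).continuousAt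
  -- at a jump point `x ∈ s`: both one-sided limits of `G` equal `G x` (midpoint convention)
  have hcont_ne : ∀ a ∈ s, a ≠ x →
      Tendsto (fun y ↦ (l₂ a - l₁ a) * (((Real.sign (y - a) * Real.exp (-|y - a|) / 2 : ℝ)) : ℂ))
        (𝓝 x) (𝓝 ((l₂ a - l₁ a) * (((Real.sign (x - a) * Real.exp (-|x - a|) / 2 : ℝ)) : ℂ))) := by
    intro a _ hax
    have hxa : x - a ≠ 0 := sub_ne_zero.2 (Ne.symm hax)
    exact (((hasDerivAt_jump hxa).comp_sub_const x a).const_mul (l₂ a - l₁ a)).continuousAt.tendsto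
  have hleft_sum : ∀ a ∈ s,
      Tendsto (fun y ↦ (l₂ a - l₁ a) * (((Real.sign (y - a) * Real.exp (-|y - a|) / 2 : ℝ)) : ℂ))
        (𝓝[<] x) (𝓝 ((l₂ a - l₁ a) *
          (if a = x then (((-1 / 2 : ℝ)) : ℂ) else
            (((Real.sign (x - a) * Real.exp (-|x - a|) / 2 : ℝ)) : ℂ)))) := by
    intro a ha
    split_ifs with hax
    · subst hax
      exact (tendsto_jump_nhdsLT.comp (tendsto_sub_nhdsLT a)).const_mul _
    · exact (hcont_ne a ha hax).mono_left nhdsWithin_le_nhds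
  have hright_sum : ∀ a ∈ s,
      Tendsto (fun y ↦ (l₂ a - l₁ a) * (((Real.sign (y - a) * Real.exp (-|y - a|) / 2 : ℝ)) : ℂ))
        (𝓝[>] x) (𝓝 ((l₂ a - l₁ a) *
          (if a = x then (((1 / 2 : ℝ)) : ℂ) else
            (((Real.sign (x - a) * Real.exp (-|x - a|) / 2 : ℝ)) : ℂ)))) := by
    intro a ha
    split_ifs with hax
    · subst hax
      exact (tendsto_jump_nhdsGT.comp (tendsto_sub_nhdsGT a)).const_mul _
    · exact (hcont_ne a ha hax).mono_left nhdsWithin_le_nhds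
  have hsum_erase : ∀ c : ℂ,
      ∑ a ∈ s.erase x, (l₂ a - l₁ a) *
          (if a = x then c else (((Real.sign (x - a) * Real.exp (-|x - a|) / 2 : ℝ)) : ℂ)) =
        ∑ a ∈ s.erase x, (l₂ a - l₁ a) *
          (((Real.sign (x - a) * Real.exp (-|x - a|) / 2 : ℝ)) : ℂ) := fun c ↦
    Finset.sum_congr rfl fun a ha ↦ by rw [if_neg (Finset.ne_of_mem_erase ha)]
  have hGx :
      F x - ∑ a ∈ s, (l₂ a - l₁ a) * (((Real.sign (x - a) * Real.exp (-|x - a|) / 2 : ℝ)) : ℂ) =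
        (l₁ x + l₂ x) / 2 -
          ∑ a ∈ s.erase x, (l₂ a - l₁ a) *
            (((Real.sign (x - a) * Real.exp (-|x - a|) / 2 : ℝ)) : ℂ) := by
    rw [← Finset.add_sum_erase s _ hx, sub_self, jump_zero, mul_zero, zero_add, hmid x hx]
  have hleft : Tendsto
      (fun y ↦ F y - ∑ a ∈ s, (l₂ a - l₁ a) *
        (((Real.sign (y - a) * Real.exp (-|y - a|) / 2 : ℝ)) : ℂ))
      (𝓝[<] x) (𝓝 (F x - ∑ a ∈ s, (l₂ a - l₁ a) *
        (((Real.sign (x - a) * Real.exp (-|x - a|) / 2 : ℝ)) : ℂ))) := by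
    have h := (h₁ x hx).sub (tendsto_finsetSum s hleft_sum)
    rw [hGx]
    convert h using 2
    rw [← Finset.add_sum_erase s _ hx, if_pos rfl, hsum_erase]
    push_cast
    ring
  have hright : Tendsto
      (fun y ↦ F y - ∑ a ∈ s, (l₂ a - l₁ a) *
        (((Real.sign (y - a) * Real.exp (-|y - a|) / 2 : ℝ)) : ℂ))
      (𝓝[>] x) (𝓝 (F x - ∑ a ∈ s, (l₂ a - l₁ a) *
        (((Real.sign (x - a) * Real.exp (-|x - a|) / 2 : ℝ)) : ℂ))) := by
    have h := (h₂ x hx).sub (tendsto_finsetSum s hright_sum)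
    rw [hGx]
    convert h using 2
    rw [← Finset.add_sum_erase s _ hx, if_pos rfl, hsum_erase]
    push_cast
    ring
  exact continuousAt_iff_continuous_left_right.2
    ⟨continuousWithinAt_Iio_iff_Iic.1 hleft, continuousWithinAt_Ioi_iff_Ici.1 hright⟩

/-! ## Decay of the transform on Weil's class -/

/-- **Decay of `Φ₀` on the critical line for Weil's class (A), (B)**: there is `C = C(F)` with
`‖Φ(½ + iγ)‖ · (1 + |γ|) ≤ C` for all real `γ` (`Φ = weilMellin F`).  This is the quantitative
content of Weil's remark that the zero sum (11) converges for `F` in (A), (B): one integration by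
parts, the jumps contributing `O(1/|γ|)` boundary terms.
[cite: Weil1952FormulesExplicites, conditions (A), (B) p. 257 and (11) pp. 261–262] -/
theorem _root_.Literature.NumberTheory.LFunctions.IsWeil1952Test.exists_norm_weilMellin_mul_le
    {F : ℝ → ℂ} (hF : IsWeil1952Test F) :
    ∃ C : ℝ, ∀ γ : ℝ, ‖weilMellin F (1 / 2 + γ * I)‖ * (1 + |γ|) ≤ C := by
  obtain ⟨⟨s, hFs, hA⟩, ⟨b, hb, hOF, hOF'⟩⟩ := hF
  have hA₁ := fun a ha ↦ (hA a ha).1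
  have hA₂ := fun a ha ↦ (hA a ha).2
  choose! l₁ l₂ hl₁ hl₂ hmid using hA₁
  choose! d₁ d₂ hd₁ hd₂ using hA₂
  have hopen : IsOpen ((↑s : Set ℝ)ᶜ) := s.finite_toSet.isClosed.isOpen_compl
  have hcF : ContinuousOn F (↑s : Set ℝ)ᶜ := hFs.continuousOn
  have hcF' : ContinuousOn (deriv F) (↑s : Set ℝ)ᶜ := hFs.continuousOn_deriv_of_isOpen hopen le_rfl
  have hFi : Integrable F :=
    integrable_of_condAB_aux hcF (fun a ha ↦ ⟨_, _, hl₁ a ha, hl₂ a ha⟩) hb hOF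
  have hF'i : Integrable (deriv F) :=
    integrable_of_condAB_aux hcF' (fun a ha ↦ ⟨_, _, hd₁ a ha, hd₂ a ha⟩) hb hOF'
  have hF0 : Tendsto F (cocompact ℝ) (𝓝 0) :=
    hOF.trans_tendsto (tendsto_exp_neg_mul_abs_cocompact (by linarith))
  -- the jump-corrected function `G` and its derivative profile `G'`
  set G : ℝ → ℂ := fun x ↦
    F x - ∑ a ∈ s, (l₂ a - l₁ a) * (((Real.sign (x - a) * Real.exp (-|x - a|) / 2 : ℝ)) : ℂ) with hG
  set G' : ℝ → ℂ := fun x ↦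
    deriv F x - ∑ a ∈ s, (l₂ a - l₁ a) * (((-Real.exp (-|x - a|) / 2 : ℝ)) : ℂ) with hG'
  have hJR := jump_removal hFs hl₁ hl₂ hmid
  have hGc : Continuous G := hJR.1
  have hGd : ∀ x, x ∉ (↑s : Set ℝ) → HasDerivAt G (G' x) x := fun x hx ↦ hJR.2 x (by simpa using hx)
  have hGi : Integrable G :=
    hFi.sub (integrable_finsetSum _ fun a _ ↦ (integrable_jump.comp_sub_right a).const_mul _)
  have hG'i : Integrable G' :=
    hF'i.sub (integrable_finsetSum _ fun a _ ↦ (integrable_jumpDeriv.comp_sub_right a).const_mul _)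
  have hG0 : Tendsto G (cocompact ℝ) (𝓝 0) := by
    have h : Tendsto
        (fun x ↦ ∑ a ∈ s, (l₂ a - l₁ a) * (((Real.sign (x - a) * Real.exp (-|x - a|) / 2 : ℝ)) : ℂ))
        (cocompact ℝ)
        (𝓝 (∑ a ∈ s, (l₂ a - l₁ a) * 0)) :=
      tendsto_finsetSum _ fun a _ ↦ (tendsto_jump_comp_sub_cocompact a).const_mul _
    simp only [mul_zero, Finset.sum_const_zero] at h
    have h2 := hF0.sub h
    rw [sub_zero] at h2
    exact h2
  have key := fun γ ↦ integral_mul_cexp_eq_of_hasDerivAt_off_countable s.countable_toSet hGc hGd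
    hGi hG'i (hG0.mono_left atTop_le_cocompact) (hG0.mono_left atBot_le_cocompact) γ
  refine ⟨(∫ t, ‖G t‖) + (∫ t, ‖G' t‖) + ∑ a ∈ s, ‖l₂ a - l₁ a‖ * (3 / 2), fun γ ↦ ?_⟩
  -- integrability of the pieces against `e^{iγt}`
  have hiG := integrable_mul_cexp hGi γ
  have hij : ∀ a : ℝ, Integrable fun t : ℝ ↦
      (l₂ a - l₁ a) *
        ((((Real.sign (t - a) * Real.exp (-|t - a|) / 2 : ℝ)) : ℂ) * cexp (γ * I * t)) :=
    fun a ↦ (integrable_mul_cexp (integrable_jump.comp_sub_right a) γ).const_mul _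
  -- decomposition of the transform
  have hdecomp : weilMellin F (1 / 2 + γ * I) =
      (∫ t, G t * cexp (γ * I * t)) +
        ∑ a ∈ s, (l₂ a - l₁ a) * (cexp (γ * I * a) * (γ * I / (1 + γ ^ 2))) := by
    rw [weilMellin_half_add]
    have hpt : ∀ t : ℝ, F t * cexp (γ * I * t) =
        G t * cexp (γ * I * t) + ∑ a ∈ s, (l₂ a - l₁ a) *
          ((((Real.sign (t - a) * Real.exp (-|t - a|) / 2 : ℝ)) : ℂ) * cexp (γ * I * t)) := by
      intro t
      simp only [hG, sub_mul, Finset.sum_mul, mul_assoc]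
      ring
    simp_rw [hpt]
    rw [integral_add hiG (integrable_finsetSum _ fun a _ ↦ hij a),
      integral_finsetSum _ fun a _ ↦ hij a]
    congr 1
    refine Finset.sum_congr rfl fun a _ ↦ ?_
    have htr :
        ∫ t : ℝ, (((Real.sign (t - a) * Real.exp (-|t - a|) / 2 : ℝ)) : ℂ) * cexp (γ * I * t) =
          cexp (γ * I * a) *
            ∫ t : ℝ, (((Real.sign t * Real.exp (-|t|) / 2 : ℝ)) : ℂ) * cexp (γ * I * t) :=
      integral_comp_sub_mul_cexp (fun x : ℝ ↦ (((Real.sign x * Real.exp (-|x|) / 2 : ℝ)) : ℂ)) a γ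
    rw [integral_const_mul, htr, integral_jump_mul_cexp]
  -- the continuous part: `‖Ĝ‖ (1 + |γ|) ≤ ‖G‖₁ + ‖G'‖₁`
  have hGγ : ‖∫ t, G t * cexp (γ * I * t)‖ * (1 + |γ|) ≤ (∫ t, ‖G t‖) + ∫ t, ‖G' t‖ := by
    rw [mul_add, mul_one]
    refine add_le_add (norm_integral_mul_cexp_le G γ) ?_
    have h : ‖(γ * I) * ∫ t, G t * cexp (γ * I * t)‖ = ‖∫ t, G t * cexp (γ * I * t)‖ * |γ| := by
      rw [norm_mul, norm_mul, Complex.norm_I, mul_one, Complex.norm_real, Real.norm_eq_abs,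
        mul_comm]
    rw [← h, key, norm_neg]
    exact norm_integral_mul_cexp_le G' γ
  -- the jump parts: each `≤ ‖J_a‖ · 3/2`
  have hJγ : ∀ a ∈ s, ‖(l₂ a - l₁ a) * (cexp (γ * I * a) * (γ * I / (1 + γ ^ 2)))‖ * (1 + |γ|) ≤
      ‖l₂ a - l₁ a‖ * (3 / 2) := by
    intro a _
    rw [norm_mul, norm_mul, norm_cexp_mul_I_mul, one_mul, mul_assoc]
    exact mul_le_mul_of_nonneg_left (norm_jumpTransform_mul_le γ) (norm_nonneg _)
  calc ‖weilMellin F (1 / 2 + γ * I)‖ * (1 + |γ|)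
      ≤ (‖∫ t, G t * cexp (γ * I * t)‖ +
          ∑ a ∈ s, ‖(l₂ a - l₁ a) * (cexp (γ * I * a) * (γ * I / (1 + γ ^ 2)))‖) * (1 + |γ|) := by
        rw [hdecomp]
        exact mul_le_mul_of_nonneg_right
          ((norm_add_le _ _).trans (add_le_add le_rfl (norm_sum_le _ _))) (by positivity)
    _ = ‖∫ t, G t * cexp (γ * I * t)‖ * (1 + |γ|) +
          ∑ a ∈ s, ‖(l₂ a - l₁ a) * (cexp (γ * I * a) * (γ * I / (1 + γ ^ 2)))‖ * (1 + |γ|) := by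
        rw [add_mul, Finset.sum_mul]
    _ ≤ (∫ t, ‖G t‖) + (∫ t, ‖G' t‖) + ∑ a ∈ s, ‖l₂ a - l₁ a‖ * (3 / 2) :=
        add_le_add hGγ (Finset.sum_le_sum hJγ)

/-! ## The transform of `F₀ ⋆ F̃₀` on the critical line for integrable `F₀` -/

/-- **Multiplicativity on the critical line under `L¹` hypotheses**: `(f ⋆ g)^(s) = f̂(s) ĝ(s)` for
integrable `f, g` and `Re s = ½` (Fubini: `MeasureTheory.integral_convolution`, with
`|e^{(s−½)t}| = 1`; same computation as `weilMellin_weilConv_holds`, which assumes continuity and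
compact support instead).  Bombieri 2000 §2: the Mellin transform of the (multiplicative)
convolution is the product of the transforms. [cite: Bombieri2000Weil, §2] -/
theorem weilMellin_weilConv_of_integrable {f g : ℝ → ℂ} (hf : Integrable f) (hg : Integrable g)
    {s : ℂ} (hs : s.re = 1 / 2) :
    weilMellin (weilConv f g) s = weilMellin f s * weilMellin g s := by
  set c : ℂ := s - 1 / 2 with hc
  have hcre : c.re = 0 := by simp [hc, hs]
  have hnorm : ∀ u : ℝ, ‖cexp (c * u)‖ = 1 := fun u ↦ by
    rw [Complex.norm_exp]
    simp [Complex.mul_re, hcre]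
  set G : ℝ → ℂ := fun u ↦ f u * cexp (c * u) with hG
  set H : ℝ → ℂ := fun u ↦ g u * cexp (c * u) with hH
  have hGi : Integrable G := hf.norm.mono' (hf.aestronglyMeasurable.mul (by fun_prop))
    (Eventually.of_forall fun u ↦ by simp [hG, hnorm])
  have hHi : Integrable H := hg.norm.mono' (hg.aestronglyMeasurable.mul (by fun_prop))
    (Eventually.of_forall fun u ↦ by simp [hH, hnorm])
  have key : ∀ t : ℝ, weilConv f g t * cexp (c * t) = (G ⋆[ContinuousLinearMap.mul ℂ ℂ] H) t := by
    intro t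
    rw [weilConv_apply, convolution_def, ← integral_mul_const]
    congr 1 with u
    simp only [hG, hH, ContinuousLinearMap.mul_apply']
    have he : cexp (c * t) = cexp (c * u) * cexp (c * ((t - u : ℝ) : ℂ)) := by
      rw [← Complex.exp_add]
      push_cast
      ring_nf
    rw [he]
    ring
  have hL : weilMellin (weilConv f g) s = ∫ t : ℝ, (G ⋆[ContinuousLinearMap.mul ℂ ℂ] H) t := by
    unfold weilMellin
    exact integral_congr_ae (Eventually.of_forall fun t ↦ key t)
  rw [hL, integral_convolution (ContinuousLinearMap.mul ℂ ℂ) hGi hHi,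
    ContinuousLinearMap.mul_apply']
  rfl

/-- The involution preserves integrability: `F̃₀(t) = conj F₀(−t)` is integrable if `F₀` is.
[folklore] -/
private theorem integrable_weilReflect {F₀ : ℝ → ℂ} (hF : Integrable F₀) :
    Integrable (weilReflect F₀) := by
  have hneg : Integrable fun t : ℝ ↦ F₀ (-t) := hF.comp_neg
  refine hneg.norm.mono'
    (Complex.continuous_conj.comp_aestronglyMeasurable hneg.aestronglyMeasurable)
    (Eventually.of_forall fun t ↦ ?_)
  simp [weilReflect]

/-- **On the critical line the transform of `F₀ ⋆ F̃₀` is a squared modulus**, for every integrable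
`F₀`: `(F₀ ⋆ F̃₀)^(ρ) = Φ₀(ρ) · conj Φ₀(ρ) = |Φ₀(ρ)|²` when `Re ρ = ½` (Weil 1952 p. 262; Bombieri
2000 §3 (3.2)).  Extends `weilMellin_weilQuadratic_of_re_eq` from `C_c^∞` to `L¹`.
[cite: Weil1952FormulesExplicites, p. 262] -/
theorem weilMellin_autocorr_of_integrable {F₀ : ℝ → ℂ} (hF : Integrable F₀) {ρ : ℂ}
    (hρ : ρ.re = 1 / 2) :
    weilMellin (weilConv F₀ (weilReflect F₀)) ρ = (Complex.normSq (weilMellin F₀ ρ) : ℂ) := by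
  have h1 : 1 - conj ρ = ρ := by
    apply Complex.ext
    · simp only [sub_re, one_re, conj_re, hρ]
      norm_num
    · simp
  rw [weilMellin_weilConv_of_integrable hF (integrable_weilReflect hF) hρ,
    weilMellin_weilReflect_holds, h1, Complex.mul_conj]

end Weil1952

/-! ## The discharge -/

open Weil1952 in
/-- **The «il faut» half of Weil's lemma on Weil's own class, for `ζ`**: under the Riemann
hypothesis, for every `F₀` satisfying (A), (B) the symmetric zero sum of `F₀ ⋆ F̃₀` converges, to a
value `≥ 0`.  Weil 1952, p. 262: "celle de F est `Φ(s) = Φ₀(s) \overline{Φ₀(1 − s̄)}`. Si donc tous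
les zéros `ω` de `L(s)` dans la bande critique sont sur `σ = ½`, le premier membre de (11) est
`≥ 0`" — on the critical line `Φ(ω) = |Φ₀(ω)|²`; here the sum converges absolutely since
`|Φ₀(½ + iγ)|² ≤ C²/‖ρ‖²` (`IsWeil1952Test.exists_norm_weilMellin_mul_le`) and
`Σ_{Re ρ ≥ ¼} m(ρ)/‖ρ‖² < ∞` (`summable_zeroOrder_div_norm_sq`, Titchmarsh Thm. 9.2).
[cite: Weil1952FormulesExplicites, the «lemme» p. 262 («il faut»)] -/
theorem Weil1952_criterion_zeta_mp (hRH : RiemannHypothesis) {F₀ : ℝ → ℂ}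
    (hF₀ : IsWeil1952Test F₀) :
    ∃ Z : ℂ, HasWeilZeroSide (weilConv F₀ (weilReflect F₀)) Z ∧ 0 ≤ Z := by
  obtain ⟨C, hC⟩ := hF₀.exists_norm_weilMellin_mul_le
  have hint : Integrable F₀ := hF₀.integrable
  have hre : ∀ ρ ∈ ZetaZeros.riemannZetaNontrivialZeros, ρ.re = 1 / 2 := by
    intro ρ hρ
    refine hRH ρ (ZetaZeros.riemannZetaNontrivialZeros.zeta_eq_zero hρ) ?_
      (ZetaZeros.riemannZetaNontrivialZeros.ne_one hρ)
    rintro ⟨n, hn⟩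
    have him := ZetaZeros.riemannZetaNontrivialZeros.im_ne_zero hρ
    rw [hn] at him
    simp at him
  have hterm : ∀ ρ ∈ ZetaZeros.riemannZetaNontrivialZeros,
      weilMellin (weilConv F₀ (weilReflect F₀)) ρ = (Complex.normSq (weilMellin F₀ ρ) : ℂ) :=
    fun ρ hρ ↦ weilMellin_autocorr_of_integrable hint (hre ρ hρ)
  -- `|Φ(ρ)| = |Φ₀(ρ)|² ≤ C²/(1 + |γ|)² ≤ C²/‖ρ‖²` (`‖ρ‖² = ¼ + γ²` on the critical line)
  have hbound : ∀ ρ ∈ ZetaZeros.riemannZetaNontrivialZeros,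
      ‖weilMellin (weilConv F₀ (weilReflect F₀)) ρ‖ ≤ C ^ 2 / ‖ρ‖ ^ 2 := by
    intro ρ hρ
    have hρeq : (1 / 2 + ρ.im * I : ℂ) = ρ := by
      apply Complex.ext
      · simp [hre ρ hρ]
      · simp
    have h1 := hC ρ.im
    rw [hρeq] at h1
    have hpos : 0 < 1 + |ρ.im| := by positivity
    have h2 : ‖weilMellin F₀ ρ‖ ≤ C / (1 + |ρ.im|) := by
      rw [le_div_iff₀ hpos]
      exact h1
    have h3 : ‖weilMellin F₀ ρ‖ ^ 2 ≤ (C / (1 + |ρ.im|)) ^ 2 :=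
      pow_le_pow_left₀ (norm_nonneg _) h2 2
    have hnorm : ‖ρ‖ ^ 2 = 1 / 4 + ρ.im ^ 2 := by
      rw [← Complex.normSq_eq_norm_sq, Complex.normSq_apply, hre ρ hρ]
      ring
    have hρ0 : 0 < ‖ρ‖ ^ 2 := by
      rw [hnorm]
      positivity
    rw [hterm ρ hρ, Complex.norm_real, Real.norm_eq_abs, abs_of_nonneg (Complex.normSq_nonneg _),
      Complex.normSq_eq_norm_sq]
    refine h3.trans ?_
    rw [div_pow, div_le_div_iff₀ (by positivity) hρ0, hnorm]
    have h4 : 1 / 4 + ρ.im ^ 2 ≤ (1 + |ρ.im|) ^ 2 := by nlinarith [abs_nonneg ρ.im, sq_abs ρ.im]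
    exact mul_le_mul_of_nonneg_left h4 (sq_nonneg C)
  -- absolute convergence: under RH every non-trivial zero lies in `zetaZerosRight`
  -- (`Re ρ = ½ ≥ ¼`), over which `Σ m(ρ)/‖ρ‖² < ∞` (`summable_zeroOrder_div_norm_sq`,
  -- Jensen / Titchmarsh Thm. 9.2)
  have hsum : Summable fun ρ : ZetaZeros.riemannZetaNontrivialZeros ↦
      ‖(riemannZetaZeroOrder (ρ : ℂ) : ℂ) * weilMellin (weilConv F₀ (weilReflect F₀)) ρ‖ := by
    let i : ZetaZeros.riemannZetaNontrivialZeros → zetaZerosRight := fun ρ ↦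
      ⟨(ρ : ℂ), ZetaZeros.riemannZetaNontrivialZeros.zeta_eq_zero ρ.2, by rw [hre _ ρ.2]; norm_num⟩
    have hi : Function.Injective i := by
      intro a b hab
      have h := congrArg Subtype.val hab
      exact Subtype.ext h
    have hS := (summable_zeroOrder_div_norm_sq.comp_injective hi).mul_left (C ^ 2)
    refine Summable.of_nonneg_of_le (fun _ ↦ norm_nonneg _) (fun ρ ↦ ?_) hS
    have hm : (0 : ℝ) ≤ riemannZetaZeroOrder (ρ : ℂ) := by
      exact_mod_cast riemannZetaZeroOrder_nonneg (ZetaZeros.riemannZetaNontrivialZeros.ne_one ρ.2)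
    rw [norm_mul, Complex.norm_intCast, abs_of_nonneg hm]
    calc (riemannZetaZeroOrder (ρ : ℂ) : ℝ) * ‖weilMellin (weilConv F₀ (weilReflect F₀)) ρ‖
        ≤ (riemannZetaZeroOrder (ρ : ℂ) : ℝ) * (C ^ 2 / ‖(ρ : ℂ)‖ ^ 2) :=
          mul_le_mul_of_nonneg_left (hbound ρ ρ.2) hm
      _ = C ^ 2 * ((riemannZetaZeroOrder (ρ : ℂ) : ℝ) / ‖(ρ : ℂ)‖ ^ 2) := by ring
  refine ⟨_, hasWeilZeroSide_tsum hsum, ?_⟩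
  have hfun : (fun ρ : ZetaZeros.riemannZetaNontrivialZeros ↦
      (riemannZetaZeroOrder (ρ : ℂ) : ℂ) * weilMellin (weilConv F₀ (weilReflect F₀)) ρ) =
      fun ρ : ZetaZeros.riemannZetaNontrivialZeros ↦
        (((riemannZetaZeroOrder (ρ : ℂ) : ℝ) * Complex.normSq (weilMellin F₀ ρ) : ℝ) : ℂ) := by
    funext ρ
    rw [hterm ρ ρ.2]
    push_cast
    ring
  rw [hfun, ← Complex.ofReal_tsum]
  refine Complex.zero_le_real.2 (tsum_nonneg fun ρ ↦ mul_nonneg ?_ (Complex.normSq_nonneg _))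
  exact_mod_cast riemannZetaZeroOrder_nonneg (ZetaZeros.riemannZetaNontrivialZeros.ne_one ρ.2)

/-- **Weil's criterion AS PRINTED (Weil 1952, the «lemme» p. 262), case `L = ζ`, is a theorem**:
`RiemannHypothesis ↔` for every `F₀` in Weil's class (A), (B) the symmetric zero sum of
`F₀ * \overline{F₀(−x)}` converges to a value `≥ 0`.  Discharges the named fact
`Literature.NumberTheory.LFunctions.Weil1952_criterion_zeta` (`Weil1952Criterion.lean`): «il suffit»
is `Weil1952_criterion_zeta_mpr` there (restriction to `C_c^∞` and Bombieri 2000 Thm. 1's converse,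
`weil_criterion_zeroSide_converse_holds`); «il faut» is `Weil1952_criterion_zeta_mp` above.
[cite: Weil1952FormulesExplicites, the «lemme» p. 262] -/
theorem Weil1952_criterion_zeta_holds : Weil1952_criterion_zeta :=
  Weil1952_criterion_zeta_of_mp fun hRH _ hF₀ ↦ Weil1952_criterion_zeta_mp hRH hF₀

end Literature.NumberTheory.LFunctions

end
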